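import Summits.CriticalPhenomena.PercolationContinuityZ3.Theorems.PercNearOneGluingNoHeavyLowerTailKnQuestion8CoefficientwisePointEdgeIdentity
import HarnessLib

/-!
# PEM for point edges to `p ∉ {x, y}` alone implies CONJECTURE NO-CORE at every point — prim-lf-2 gen 54

Support file (`--supports stmt-CriticalPhenomena-4575`, closed), prover `prim-lf-2` (gen 54).  No definitions, no named facts, no sorries; standard axioms.
Memo `prim-lf-2/CW-SERIES-gen53.md` §9 and `prim-lf-2/CW-MATCHING-gen54.md` §1.

Setting.  Finite multigraph `ends : ι → Sym2 V`, root `x`, `K(s) = openCluster (ends '' s) x` (red cluster of the colouring `s`, blue cluster `K(sᶜ)`);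
`NO-CORE(y)[1_u,g] := Σ_{s : ¬(y ∈ K s ∧ y ∈ K sᶜ)} ([u ∈ K s] − [u ∈ K sᶜ])·(g(K s) − g(K sᶜ))` (raw sum over the `2^{|ι|}` colourings; CONJECTURE NO-CORE, prim-lf-2 gen 46:
`≥ 0` for monotone `g`).  CONJECTURE PEM (point-edge monotonicity, prim-lf-2 gen 53): deleting an edge `e = up` at the point `u` with `p ∉ {x, y, u}` does not increase
the raw sum.  Gen 53's reduction `…CoefficientwisePointEdgeReduction.lean` (`noCore_point_nonneg_of_pem`) assumed PEM also for the ROOT edges `p = x` (which is the separate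
root-edge monotonicity conjecture `S_{D2} ≥ 0` of `…CoefficientwiseRootEdgeMonotone.lean`).  This file removes that assumption:
* `noCore_point_eq_zero_of_no_edge` — a point met by no edge contributes `0` (type-level form of gen 53's `noCore_point_eq_zero_of_isolated`);
* `noCore_point_parallelRootEdge_eq` — **two parallel root edges `e₁, e₂ = xu` at the point: `NO-CORE^G(y)[1_u,g] = NO-CORE^{G−e₁}(y)[1_u,g]` exactly** (raw sums; the
  colourings giving `e₁, e₂` different colours put `u` in the core and contribute `0`, the others are the colourings of `G − e₁`) — no hypothesis on `g` or on the other edges;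
* `noCore_point_singleRootEdge_nonneg` — **if the only edge at `u` is one root edge `xu`, then `NO-CORE(y)[1_u,g] ≥ 0`** for monotone `g` (`= 2·Σ_r [y ∉ core′ r]·(g(K′r ∪ {u}) − g(K′r))`
  on `G − e₁` after the colour swap);
* `noCore_point_nonneg_of_pem_sharp` — **THEOREM: PEM for point edges `e = up` with `p ∉ {x, y, u}` (as a hypothesis, for all finite multigraphs on `V` with edge types in one
  universe) implies `0 ≤ NO-CORE(y)[1_u,g]` on every such multigraph** (`u ≠ x`, `u ≠ y`, no loop at `u`, `g` monotone): strong induction on the number of edges — delete point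
  edges to `p ∉ {x,y}` (PEM); then either an edge `uy` exists (gen 48 `noCore_adj_point_nonneg`), or all edges at `u` are root edges: two of them ⇒ delete one for free
  (`noCore_point_parallelRootEdge_eq`), one ⇒ `noCore_point_singleRootEdge_nonneg`, none ⇒ `0`.
Exact census of PEM (prim-lf-2 gen 53/54, min over ALL monotone `g` by min-closure): 0 exceptions on all graphs with ≤ 7 vertices (115 055 520 `(G,e,u,y)`, kit j212999/j213000),
on LOBE(2,2)…(7,7)(+leaf), Petersen, Q3, K33–K45, K5, K6, W7, prism, theta and 240 random graphs on 9–11 vertices (j213015, j213071); n = 8, m ≤ 11 running (j220717/721/725).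
[cite: KozmaNitzan2024, Questions 8–9 (§5.5 p. 36) (context: the Question-8 pocket covariance programme)]
-/

namespace Summit.CriticalPhenomena.PercolationContinuityZ3.Theorems

open Finset Literature.Probability.Percolation

namespace Coefficientwise

universe uV uE

section basic

variable {ι V : Type*} [Fintype ι] [DecidableEq ι] (ends : ι → Sym2 V) (x u y : V) (g : Set V → ℝ)

omit [Fintype ι] [DecidableEq ι] in
/-- An edge `j ∈ s` with ends `{u, x}` puts `u` in the red cluster `C_x(s)`. [cite: KozmaNitzan2024, §5.5 (context only; elementary)] -/
private theorem mem_openCluster_of_rootEdge (s : Finset ι) {j : ι} (hj : j ∈ s) (hju : ends j = s(u, x)) (hux : u ≠ x) :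
    u ∈ openCluster (ends '' (↑s : Set ι)) x := by
  have hadj : (openGraph (ends '' (↑s : Set ι))).Adj x u := by
    rw [openGraph_image_adj]
    exact ⟨⟨j, hj, by rw [hju, Sym2.eq_swap]⟩, hux.symm⟩
  exact hadj.reachable

omit [Fintype ι] [DecidableEq ι] in
/-- Reachability is an equivalence: if `u ∈ C_x(F)` then `C_u(F) = C_x(F)`. [cite: KozmaNitzan2024, §5.5 (context only; elementary)] -/
private theorem openCluster_eq_of_mem_root (F : Set (Sym2 V)) (h : u ∈ openCluster F x) : openCluster F u = openCluster F x := by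
  have h' : (openGraph F).Reachable x u := h
  ext v
  constructor
  · intro hv
    have hv' : (openGraph F).Reachable u v := hv
    exact h'.trans hv'
  · intro hv
    have hv' : (openGraph F).Reachable x v := hv
    exact h'.symm.trans hv'

omit [Fintype ι] [DecidableEq ι] in
/-- If no edge of `s` meets `u`, the red cluster of `u` is `{u}`. [cite: KozmaNitzan2024, §5.5 (context only; elementary)] -/
private theorem openCluster_subset_singleton_of_no_edge (s : Finset ι) (hs : ∀ i ∈ s, u ∉ ends i) :
    openCluster (ends '' (↑s : Set ι)) u ⊆ ({u} : Set V) := by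
  refine openCluster_subset_of_adjClosed ends u (↑s : Set ι) ({u} : Set V) (Set.mem_singleton u) ?_
  intro a ha b hab
  rw [openGraph_image_adj] at hab
  obtain ⟨⟨i, hi, hiab⟩, _⟩ := hab
  have hau : a = u := ha
  exfalso
  apply hs i (Finset.mem_coe.mp hi)
  rw [hiab, hau]
  exact Sym2.mem_mk_left _ _

open Classical in
/-- **A point met by no edge contributes nothing:** if `u ≠ x` lies on no edge, `NO-CORE(y)[1_u,g] = 0`.
[cite: KozmaNitzan2024, Questions 8–9 (§5.5 p. 36) (context)] -/
theorem noCore_point_eq_zero_of_no_edge (hux : u ≠ x) (hu : ∀ j : ι, u ∉ ends j) :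
    (∑ s ∈ (univ : Finset (Finset ι)).filter (fun s : Finset ι => ¬ (y ∈ openCluster (ends '' (↑s : Set ι)) x ∧ y ∈ openCluster (ends '' (↑(sᶜ) : Set ι)) x)),
      (((if u ∈ openCluster (ends '' (↑s : Set ι)) x then (1 : ℝ) else 0) - (if u ∈ openCluster (ends '' (↑(sᶜ) : Set ι)) x then (1 : ℝ) else 0)) *
        (g (openCluster (ends '' (↑s : Set ι)) x) - g (openCluster (ends '' (↑(sᶜ) : Set ι)) x)))) = 0 := by
  refine Finset.sum_eq_zero fun s _ => ?_
  have h1 : u ∉ openCluster (ends '' (↑s : Set ι)) x := not_mem_openCluster_of_no_edge ends x s hux.symm (fun i _ => hu i)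
  have h2 : u ∉ openCluster (ends '' (↑(sᶜ) : Set ι)) x := not_mem_openCluster_of_no_edge ends x sᶜ hux.symm (fun i _ => hu i)
  rw [if_neg h1, if_neg h2, sub_zero, zero_mul]

open Classical in
/-- **Two parallel root edges at the point cost nothing.**  If `e₁ ≠ e₂` both have ends `{u, x}` (`u ≠ x`), then for every `y` and EVERY `g`,
`NO-CORE^G(y)[1_u,g] = NO-CORE^{G−e₁}(y)[1_u,g]` (raw sums; `G − e₁` = edge type `{j // j ∉ {e₁}}`): the colourings of `G` giving `e₁, e₂` different colours have `u` in the
core (`[u ∈ K] − [u ∈ K̄] = 0`), and those giving them the same colour have the clusters of `G − e₁`.  [cite: KozmaNitzan2024, Questions 8–9 (§5.5 p. 36) (context)] -/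
theorem noCore_point_parallelRootEdge_eq {e₁ e₂ : ι} (hne : e₁ ≠ e₂) (he₁ : ends e₁ = s(u, x)) (he₂ : ends e₂ = s(u, x)) (hux : u ≠ x) :
    (∑ s ∈ (univ : Finset (Finset ι)).filter (fun s : Finset ι => ¬ (y ∈ openCluster (ends '' (↑s : Set ι)) x ∧ y ∈ openCluster (ends '' (↑(sᶜ) : Set ι)) x)),
      (((if u ∈ openCluster (ends '' (↑s : Set ι)) x then (1 : ℝ) else 0) - (if u ∈ openCluster (ends '' (↑(sᶜ) : Set ι)) x then (1 : ℝ) else 0)) *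
        (g (openCluster (ends '' (↑s : Set ι)) x) - g (openCluster (ends '' (↑(sᶜ) : Set ι)) x)))) =
    (∑ r ∈ (univ : Finset (Finset {j : ι // j ∉ ({e₁} : Finset ι)})).filter (fun r : Finset {j : ι // j ∉ ({e₁} : Finset ι)} =>
        ¬ (y ∈ openCluster ((fun j : {j : ι // j ∉ ({e₁} : Finset ι)} => ends j.1) '' (↑r : Set {j : ι // j ∉ ({e₁} : Finset ι)})) x ∧
           y ∈ openCluster ((fun j : {j : ι // j ∉ ({e₁} : Finset ι)} => ends j.1) '' (↑(rᶜ) : Set {j : ι // j ∉ ({e₁} : Finset ι)})) x)),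
      (((if u ∈ openCluster ((fun j : {j : ι // j ∉ ({e₁} : Finset ι)} => ends j.1) '' (↑r : Set {j : ι // j ∉ ({e₁} : Finset ι)})) x then (1 : ℝ) else 0) -
          (if u ∈ openCluster ((fun j : {j : ι // j ∉ ({e₁} : Finset ι)} => ends j.1) '' (↑(rᶜ) : Set {j : ι // j ∉ ({e₁} : Finset ι)})) x then (1 : ℝ) else 0)) *
        (g (openCluster ((fun j : {j : ι // j ∉ ({e₁} : Finset ι)} => ends j.1) '' (↑r : Set {j : ι // j ∉ ({e₁} : Finset ι)})) x) -
          g (openCluster ((fun j : {j : ι // j ∉ ({e₁} : Finset ι)} => ends j.1) '' (↑(rᶜ) : Set {j : ι // j ∉ ({e₁} : Finset ι)})) x)))) := by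
  set Pr : ι → Prop := fun j => j ∉ ({e₁} : Finset ι) with hPr
  set ends' : {j : ι // Pr j} → Sym2 V := fun j => ends j.1 with hends'
  set K' : Finset {j : ι // Pr j} → Set V := fun r => openCluster (ends' '' (↑r : Set {j : ι // Pr j})) x with hK'
  set U' : Finset {j : ι // Pr j} → Set V := fun r => openCluster (ends' '' (↑r : Set {j : ι // Pr j})) u with hU'
  -- left: resolve the colour of `e₁` (point-edge identity with `p = x`)
  have h1 := noCore_pointEdge_eq ends x g he₁ hux y
  rw [h1]
  -- right: NO-CORE on `G − e₁` is twice its `e₂`-red half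
  have he₂' : Pr e₂ := by
    simp only [hPr, Finset.mem_singleton]
    exact fun h => hne h.symm
  have h2 := noCore_split_edge ends' x y (⟨e₂, he₂'⟩ : {j : ι // Pr j})
    (fun a b => ((if u ∈ a then (1 : ℝ) else 0) - (if u ∈ b then (1 : ℝ) else 0)) * (g a - g b)) (fun a b => by ring)
  beta_reduce at h2
  change _ = ∑ r ∈ (univ : Finset (Finset {j : ι // Pr j})).filter (fun r => ¬ (y ∈ K' r ∧ y ∈ K' rᶜ)),
      (((if u ∈ K' r then (1 : ℝ) else 0) - (if u ∈ K' rᶜ then (1 : ℝ) else 0)) * (g (K' r) - g (K' rᶜ)))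
  change ∑ r ∈ (univ : Finset (Finset {j : ι // Pr j})).filter (fun r => ¬ (y ∈ K' r ∧ y ∈ K' rᶜ)),
      (((if u ∈ K' r then (1 : ℝ) else 0) - (if u ∈ K' rᶜ then (1 : ℝ) else 0)) * (g (K' r) - g (K' rᶜ))) =
    2 * ∑ r ∈ (univ : Finset (Finset {j : ι // Pr j})).filter (fun r => (⟨e₂, he₂'⟩ : {j : ι // Pr j}) ∈ r),
      (if ¬ (y ∈ K' r ∧ y ∈ K' rᶜ) then
        (((if u ∈ K' r then (1 : ℝ) else 0) - (if u ∈ K' rᶜ then (1 : ℝ) else 0)) * (g (K' r) - g (K' rᶜ))) else 0) at h2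
  rw [h2]
  congr 1
  rw [Finset.sum_filter]
  refine Finset.sum_congr rfl fun r _ => ?_
  -- the term of the point-edge identity at `r`
  change (if ¬ (y ∈ (K' r ∪ (if (u ∈ K' r ∨ x ∈ K' r) then (U' r ∪ K' r) else (∅ : Set V))) ∧ y ∈ K' rᶜ) then
      (((if u ∈ (K' r ∪ (if (u ∈ K' r ∨ x ∈ K' r) then (U' r ∪ K' r) else (∅ : Set V))) then (1 : ℝ) else 0) -
          (if u ∈ K' rᶜ then (1 : ℝ) else 0)) *
        (g (K' r ∪ (if (u ∈ K' r ∨ x ∈ K' r) then (U' r ∪ K' r) else (∅ : Set V))) - g (K' rᶜ)))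
      else 0) =
    (if (⟨e₂, he₂'⟩ : {j : ι // Pr j}) ∈ r then
      (if ¬ (y ∈ K' r ∧ y ∈ K' rᶜ) then
        (((if u ∈ K' r then (1 : ℝ) else 0) - (if u ∈ K' rᶜ then (1 : ℝ) else 0)) * (g (K' r) - g (K' rᶜ))) else 0)
      else 0)
  have hx : x ∈ K' r := mem_openCluster_self _ x
  rw [if_pos (Or.inr hx)]
  by_cases hr : (⟨e₂, he₂'⟩ : {j : ι // Pr j}) ∈ r
  · -- both root edges red: `u ∈ K′ r`, so `U′ r = K′ r` and the boosted cluster is `K′ r`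
    have huK : u ∈ K' r := mem_openCluster_of_rootEdge ends' x u r hr he₂ hux
    have hUK : U' r = K' r := openCluster_eq_of_mem_root x u _ huK
    have hset : K' r ∪ (U' r ∪ K' r) = K' r := by rw [hUK, Set.union_self, Set.union_self]
    have hyA : (y ∈ K' r ∪ (U' r ∪ K' r)) ↔ y ∈ K' r := by rw [hset]
    have huA : (u ∈ K' r ∪ (U' r ∪ K' r)) ↔ u ∈ K' r := by rw [hset]
    have hgA : g (K' r ∪ (U' r ∪ K' r)) = g (K' r) := by rw [hset]
    rw [if_pos hr, hgA]
    by_cases hc : ¬ (y ∈ K' r ∧ y ∈ K' rᶜ)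
    · have hc' : ¬ (y ∈ K' r ∪ (U' r ∪ K' r) ∧ y ∈ K' rᶜ) := by rw [hyA]; exact hc
      rw [if_pos hc', if_pos hc]
      by_cases hu : u ∈ K' r
      · rw [if_pos (huA.mpr hu), if_pos hu]
      · rw [if_neg (fun h => hu (huA.mp h)), if_neg hu]
    · have hc' : ¬ ¬ (y ∈ K' r ∪ (U' r ∪ K' r) ∧ y ∈ K' rᶜ) := by rw [hyA]; exact hc
      rw [if_neg hc', if_neg hc]
  · -- `e₂` blue: `u ∈ K′ rᶜ` and `u ∈ U′ r ⊆ K′ r ∪ (U′ r ∪ K′ r)` — `u` is in the core, the term vanishes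
    have hrc : (⟨e₂, he₂'⟩ : {j : ι // Pr j}) ∈ rᶜ := Finset.mem_compl.mpr hr
    have huKc : u ∈ K' rᶜ := mem_openCluster_of_rootEdge ends' x u rᶜ hrc he₂ hux
    have huA : u ∈ K' r ∪ (U' r ∪ K' r) := Or.inr (Or.inl (mem_openCluster_self _ u))
    rw [if_neg hr, if_pos huA, if_pos huKc, sub_self, zero_mul]
    split_ifs <;> rfl

open Classical in
/-- **A point hanging on one root edge:** if the only edge at `u` is a single edge `e₁ = xu` (`u ≠ x`, `u ≠ y`), then for every monotone `g`,
`0 ≤ NO-CORE(y)[1_u,g]`.  (Resolving `e₁`: the sum is `2·Σ_r [y ∉ core′ r]·(g(K′r ∪ {u}) − g(K′rᶜ))` over `G − e₁`, and `Σ_r [y ∉ core′ r]·g(K′rᶜ) = Σ_r [y ∉ core′ r]·g(K′r)`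
by the colour swap.)  [cite: KozmaNitzan2024, Questions 8–9 (§5.5 p. 36) (context)] -/
theorem noCore_point_singleRootEdge_nonneg {e₁ : ι} (he₁ : ends e₁ = s(u, x)) (hux : u ≠ x) (huy : u ≠ y)
    (honly : ∀ j : ι, u ∈ ends j → j = e₁) (hg : Monotone g) :
    0 ≤ (∑ s ∈ (univ : Finset (Finset ι)).filter (fun s : Finset ι => ¬ (y ∈ openCluster (ends '' (↑s : Set ι)) x ∧ y ∈ openCluster (ends '' (↑(sᶜ) : Set ι)) x)),
      (((if u ∈ openCluster (ends '' (↑s : Set ι)) x then (1 : ℝ) else 0) - (if u ∈ openCluster (ends '' (↑(sᶜ) : Set ι)) x then (1 : ℝ) else 0)) *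
        (g (openCluster (ends '' (↑s : Set ι)) x) - g (openCluster (ends '' (↑(sᶜ) : Set ι)) x)))) := by
  set Pr : ι → Prop := fun j => j ∉ ({e₁} : Finset ι) with hPr
  set ends' : {j : ι // Pr j} → Sym2 V := fun j => ends j.1 with hends'
  set K' : Finset {j : ι // Pr j} → Set V := fun r => openCluster (ends' '' (↑r : Set {j : ι // Pr j})) x with hK'
  set U' : Finset {j : ι // Pr j} → Set V := fun r => openCluster (ends' '' (↑r : Set {j : ι // Pr j})) u with hU'
  have h1 := noCore_pointEdge_eq ends x g he₁ hux y
  rw [h1]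
  refine mul_nonneg (by norm_num) ?_
  -- no edge of `G − e₁` meets `u`
  have hno : ∀ (r : Finset {j : ι // Pr j}), ∀ i ∈ r, u ∉ ends' i := by
    intro r i _ hui
    have : (i.1 : ι) = e₁ := honly i.1 hui
    exact i.2 (by rw [this]; exact Finset.mem_singleton_self _)
  -- the term at `r`
  have hT : ∀ r : Finset {j : ι // Pr j},
      (if ¬ (y ∈ (K' r ∪ (if (u ∈ K' r ∨ x ∈ K' r) then (U' r ∪ K' r) else (∅ : Set V))) ∧ y ∈ K' rᶜ) then
        (((if u ∈ (K' r ∪ (if (u ∈ K' r ∨ x ∈ K' r) then (U' r ∪ K' r) else (∅ : Set V))) then (1 : ℝ) else 0) -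
            (if u ∈ K' rᶜ then (1 : ℝ) else 0)) *
          (g (K' r ∪ (if (u ∈ K' r ∨ x ∈ K' r) then (U' r ∪ K' r) else (∅ : Set V))) - g (K' rᶜ)))
        else 0) =
      (if ¬ (y ∈ K' r ∧ y ∈ K' rᶜ) then g (K' r ∪ (U' r ∪ K' r)) else 0) -
        (if ¬ (y ∈ K' r ∧ y ∈ K' rᶜ) then g (K' rᶜ) else 0) := by
    intro r
    have hx : x ∈ K' r := mem_openCluster_self _ x
    rw [if_pos (Or.inr hx)]
    have hUu : U' r ⊆ ({u} : Set V) := openCluster_subset_singleton_of_no_edge ends' u r (hno r)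
    have hyU : y ∉ U' r := fun h => huy (hUu h).symm
    have hyA : (y ∈ K' r ∪ (U' r ∪ K' r)) ↔ y ∈ K' r := by
      constructor
      · rintro (h | h | h)
        · exact h
        · exact absurd h hyU
        · exact h
      · exact fun h => Or.inl h
    have huA : u ∈ K' r ∪ (U' r ∪ K' r) := Or.inr (Or.inl (mem_openCluster_self _ u))
    have huKc : u ∉ K' rᶜ := not_mem_openCluster_of_no_edge ends' x rᶜ hux.symm (hno rᶜ)
    simp only [hyA]
    rw [if_pos huA, if_neg huKc]
    by_cases hc : ¬ (y ∈ K' r ∧ y ∈ K' rᶜ)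
    · rw [if_pos hc, if_pos hc, if_pos hc]; ring
    · rw [if_neg hc, if_neg hc, if_neg hc]; ring
  rw [Finset.sum_congr rfl (fun r _ => hT r), Finset.sum_sub_distrib]
  -- the colour swap on `G − e₁`: `Σ_r [¬core′ r] g(K′ rᶜ) = Σ_r [¬core′ r] g(K′ r)`
  have hswap : ∑ r : Finset {j : ι // Pr j}, (if ¬ (y ∈ K' r ∧ y ∈ K' rᶜ) then g (K' rᶜ) else 0) =
      ∑ r : Finset {j : ι // Pr j}, (if ¬ (y ∈ K' r ∧ y ∈ K' rᶜ) then g (K' r) else 0) := by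
    refine Finset.sum_nbij' (fun r => rᶜ) (fun r => rᶜ) (fun r _ => Finset.mem_univ _) (fun r _ => Finset.mem_univ _)
      (fun r _ => compl_compl r) (fun r _ => compl_compl r) (fun r _ => ?_)
    have hiff : (¬ (y ∈ K' r ∧ y ∈ K' rᶜ)) ↔ ¬ (y ∈ K' rᶜ ∧ y ∈ K' rᶜᶜ) := by
      rw [compl_compl, and_comm]
    by_cases hc : ¬ (y ∈ K' r ∧ y ∈ K' rᶜ)
    · rw [if_pos hc, if_pos (hiff.mp hc)]
    · rw [if_neg hc, if_neg (fun h => hc (hiff.mpr h))]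
  rw [hswap, ← Finset.sum_sub_distrib]
  refine Finset.sum_nonneg fun r _ => ?_
  by_cases hc : ¬ (y ∈ K' r ∧ y ∈ K' rᶜ)
  · rw [if_pos hc, if_pos hc, sub_nonneg]
    exact hg Set.subset_union_left
  · rw [if_neg hc, if_neg hc, sub_self]

end basic

section reduction

variable {V : Type uV} (x u y : V) (g : Set V → ℝ)

open Classical in
/-- **THEOREM (prim-lf-2 gen 54): PEM for point edges to `p ∉ {x, y}` implies CONJECTURE NO-CORE at every point.**  Let `u ≠ x`, `u ≠ y`, `g` monotone.  Suppose that
for every finite multigraph `ends : κ → Sym2 V` (edge type `κ` in a fixed universe) and every edge `e` with ends `{u, p}`, `p ≠ x`, `p ≠ y`, `p ≠ u`,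
`NO-CORE^{G−e}(y)[1_u,g] ≤ NO-CORE^G(y)[1_u,g]` (CONJECTURE PEM at the point `u`, root edges NOT included).  Then `0 ≤ NO-CORE^G(y)[1_u,g]` on every finite multigraph without a
loop at `u`.  [cite: KozmaNitzan2024, Questions 8–9 (§5.5 p. 36) (context)] -/
theorem noCore_point_nonneg_of_pem_sharp (hux : u ≠ x) (huy : u ≠ y) (hg : Monotone g)
    (hPEM : ∀ (κ : Type uE) [Fintype κ] [DecidableEq κ] (ends : κ → Sym2 V) (e : κ) (p : V),
      ends e = s(u, p) → p ≠ x → p ≠ y → p ≠ u →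
      (∑ r ∈ (univ : Finset (Finset {j : κ // j ∉ ({e} : Finset κ)})).filter (fun r : Finset {j : κ // j ∉ ({e} : Finset κ)} =>
          ¬ (y ∈ openCluster ((fun j : {j : κ // j ∉ ({e} : Finset κ)} => ends j.1) '' (↑r : Set {j : κ // j ∉ ({e} : Finset κ)})) x ∧
             y ∈ openCluster ((fun j : {j : κ // j ∉ ({e} : Finset κ)} => ends j.1) '' (↑(rᶜ) : Set {j : κ // j ∉ ({e} : Finset κ)})) x)),
        (((if u ∈ openCluster ((fun j : {j : κ // j ∉ ({e} : Finset κ)} => ends j.1) '' (↑r : Set {j : κ // j ∉ ({e} : Finset κ)})) x then (1 : ℝ) else 0) -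
            (if u ∈ openCluster ((fun j : {j : κ // j ∉ ({e} : Finset κ)} => ends j.1) '' (↑(rᶜ) : Set {j : κ // j ∉ ({e} : Finset κ)})) x then (1 : ℝ) else 0)) *
          (g (openCluster ((fun j : {j : κ // j ∉ ({e} : Finset κ)} => ends j.1) '' (↑r : Set {j : κ // j ∉ ({e} : Finset κ)})) x) -
            g (openCluster ((fun j : {j : κ // j ∉ ({e} : Finset κ)} => ends j.1) '' (↑(rᶜ) : Set {j : κ // j ∉ ({e} : Finset κ)})) x)))) ≤
      (∑ s ∈ (univ : Finset (Finset κ)).filter (fun s : Finset κ => ¬ (y ∈ openCluster (ends '' (↑s : Set κ)) x ∧ y ∈ openCluster (ends '' (↑(sᶜ) : Set κ)) x)),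
        (((if u ∈ openCluster (ends '' (↑s : Set κ)) x then (1 : ℝ) else 0) - (if u ∈ openCluster (ends '' (↑(sᶜ) : Set κ)) x then (1 : ℝ) else 0)) *
          (g (openCluster (ends '' (↑s : Set κ)) x) - g (openCluster (ends '' (↑(sᶜ) : Set κ)) x)))))
    (κ : Type uE) [Fintype κ] [DecidableEq κ] (ends : κ → Sym2 V) (hloop : ∀ j : κ, ends j ≠ s(u, u)) :
    0 ≤ (∑ s ∈ (univ : Finset (Finset κ)).filter (fun s : Finset κ => ¬ (y ∈ openCluster (ends '' (↑s : Set κ)) x ∧ y ∈ openCluster (ends '' (↑(sᶜ) : Set κ)) x)),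
      (((if u ∈ openCluster (ends '' (↑s : Set κ)) x then (1 : ℝ) else 0) - (if u ∈ openCluster (ends '' (↑(sᶜ) : Set κ)) x then (1 : ℝ) else 0)) *
        (g (openCluster (ends '' (↑s : Set κ)) x) - g (openCluster (ends '' (↑(sᶜ) : Set κ)) x)))) := by
  -- strong induction on the number of edges
  suffices hmain : ∀ (n : ℕ) (κ : Type uE) [Fintype κ] [DecidableEq κ] (ends : κ → Sym2 V), Fintype.card κ = n → (∀ j : κ, ends j ≠ s(u, u)) →
      0 ≤ (∑ s ∈ (univ : Finset (Finset κ)).filter (fun s : Finset κ => ¬ (y ∈ openCluster (ends '' (↑s : Set κ)) x ∧ y ∈ openCluster (ends '' (↑(sᶜ) : Set κ)) x)),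
        (((if u ∈ openCluster (ends '' (↑s : Set κ)) x then (1 : ℝ) else 0) - (if u ∈ openCluster (ends '' (↑(sᶜ) : Set κ)) x then (1 : ℝ) else 0)) *
          (g (openCluster (ends '' (↑s : Set κ)) x) - g (openCluster (ends '' (↑(sᶜ) : Set κ)) x)))) from
    hmain (Fintype.card κ) κ ends rfl hloop
  intro n
  induction n using Nat.strong_induction_on with
  | _ n ih =>
    intro κ instF instD ends hcard hloop
    -- the sub-multigraph `G − e` and the induction hypothesis for it
    have hsub : ∀ e : κ, 0 ≤ (∑ r ∈ (univ : Finset (Finset {j : κ // j ∉ ({e} : Finset κ)})).filter (fun r : Finset {j : κ // j ∉ ({e} : Finset κ)} =>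
          ¬ (y ∈ openCluster ((fun j : {j : κ // j ∉ ({e} : Finset κ)} => ends j.1) '' (↑r : Set {j : κ // j ∉ ({e} : Finset κ)})) x ∧
             y ∈ openCluster ((fun j : {j : κ // j ∉ ({e} : Finset κ)} => ends j.1) '' (↑(rᶜ) : Set {j : κ // j ∉ ({e} : Finset κ)})) x)),
        (((if u ∈ openCluster ((fun j : {j : κ // j ∉ ({e} : Finset κ)} => ends j.1) '' (↑r : Set {j : κ // j ∉ ({e} : Finset κ)})) x then (1 : ℝ) else 0) -
            (if u ∈ openCluster ((fun j : {j : κ // j ∉ ({e} : Finset κ)} => ends j.1) '' (↑(rᶜ) : Set {j : κ // j ∉ ({e} : Finset κ)})) x then (1 : ℝ) else 0)) *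
          (g (openCluster ((fun j : {j : κ // j ∉ ({e} : Finset κ)} => ends j.1) '' (↑r : Set {j : κ // j ∉ ({e} : Finset κ)})) x) -
            g (openCluster ((fun j : {j : κ // j ∉ ({e} : Finset κ)} => ends j.1) '' (↑(rᶜ) : Set {j : κ // j ∉ ({e} : Finset κ)})) x)))) := by
      intro e
      have hlt : Fintype.card {j : κ // j ∉ ({e} : Finset κ)} < n := by
        rw [← hcard]
        exact Fintype.card_subtype_lt (p := fun j : κ => j ∉ ({e} : Finset κ)) (x := e) (by simp)
      exact ih _ hlt {j : κ // j ∉ ({e} : Finset κ)} (fun j => ends j.1) rfl (fun j => hloop j.1)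
    by_cases hA : ∃ (e : κ) (p : V), ends e = s(u, p) ∧ p ≠ x ∧ p ≠ y
    · -- a point edge to `p ∉ {x, y}`: PEM and the induction hypothesis
      obtain ⟨e, p, hep, hpx, hpy⟩ := hA
      have hpu : p ≠ u := by
        intro h; apply hloop e; rw [hep, h]
      exact le_trans (hsub e) (hPEM κ ends e p hep hpx hpy hpu)
    · push Not at hA
      by_cases hB : ∃ e : κ, ends e = s(u, y)
      · -- an edge `uy`: gen 48
        obtain ⟨e, he⟩ := hB
        have he' : ends e = s(y, u) := by rw [he, Sym2.eq_swap]
        exact noCore_adj_point_nonneg ends x y u he' huy g hg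
      · push Not at hB
        -- every edge at `u` is a root edge
        have hroot : ∀ e : κ, u ∈ ends e → ends e = s(u, x) := by
          intro e hue
          have hep : ends e = s(u, Sym2.Mem.other hue) := (Sym2.other_spec hue).symm
          by_cases hpx : Sym2.Mem.other hue = x
          · rw [hep, hpx]
          · exfalso
            have hpy : Sym2.Mem.other hue = y := hA e _ hep hpx
            exact hB e (by rw [hep, hpy])
        by_cases hC : ∃ e₁ : κ, u ∈ ends e₁
        · obtain ⟨e₁, hue₁⟩ := hC
          have he₁ : ends e₁ = s(u, x) := hroot e₁ hue₁
          by_cases hD : ∃ e₂ : κ, e₂ ≠ e₁ ∧ u ∈ ends e₂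
          · -- two parallel root edges: delete one for free
            obtain ⟨e₂, hne, hue₂⟩ := hD
            have he₂ : ends e₂ = s(u, x) := hroot e₂ hue₂
            rw [noCore_point_parallelRootEdge_eq ends x u y g hne.symm he₁ he₂ hux]
            exact hsub e₁
          · -- exactly one root edge at `u`
            push Not at hD
            exact noCore_point_singleRootEdge_nonneg ends x u y g he₁ hux huy
              (fun j hj => by
                by_contra h
                exact hD j h hj) hg
        · -- no edge at `u`
          push Not at hC
          exact le_of_eq (noCore_point_eq_zero_of_no_edge ends x u y g hux hC).symm

end reduction

end Coefficientwise

end Summit.CriticalPhenomena.PercolationContinuityZ3.Theorems
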